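import Summits.KontsevichZagierPeriods.KontsevichZagierPeriods.Theorems.RootDecompRelativeModAbsoluteCylLogSplitP01

/-! # `RootDecompRelativeModAbsoluteCylLogSplitP02` — part 2/25 of the mechanical ≤330-line split of `CylLogSplit.lean`
(split by the decomp-kz census seat for landing; mathematics unchanged; part 2 continues part 1). -/

noncomputable section
open Set MeasureTheory Filter Topology
open scoped BigOperators
open Literature.NumberTheory.Transcendental Literature.ModelTheory.ExponentialFields

namespace Summit.KontsevichZagierPeriods.RootDecompRelativeModAbsolute.Rung30571

namespace RegularisedLogLayer

namespace CylLog
variable {b : ℕ}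

/-- The fibre of the oriented cell over a base point. -/
theorem fibre_regDom_of_mem {G : Set (Fin b → ℝ)} {W : (Fin b → ℝ) → ℝ} {x : Fin b → ℝ}
    (hx : x ∈ G) :
    {t : ℝ | (Fin.snoc x t : Fin (b + 1) → ℝ) ∈ regDom G W} = Ioo 1 (W x) ∪ Ioo (W x) 1 := by
  ext t
  simp only [regDom, mem_setOf_eq, Fin.init_snoc, Fin.snoc_last, mem_union, mem_Ioo]
  exact ⟨fun h => h.2, fun h => ⟨hx, h⟩⟩

/-- Auxiliary step `fibre_regDom_of_not_mem`. [bookkeeping] -/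
theorem fibre_regDom_of_not_mem {G : Set (Fin b → ℝ)} {W : (Fin b → ℝ) → ℝ} {x : Fin b → ℝ}
    (hx : x ∉ G) :
    {t : ℝ | (Fin.snoc x t : Fin (b + 1) → ℝ) ∈ regDom G W} = ∅ := by
  ext t
  simp only [regDom, mem_setOf_eq, Fin.init_snoc, Fin.snoc_last, mem_empty_iff_false, iff_false,
    not_and]
  exact fun h _ => (hx h).elim

/-- **Fibre integral of a regularised cell**: `1_G(x) · d(x) · F_m(W(x))` (both orientations). -/
theorem fibreIntegral_reg {G : Set (Fin b → ℝ)} {d W : (Fin b → ℝ) → ℝ} (m : ℕ)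
    (R : KZ.IntegralRep (b + 1)) (hpos : ∀ x ∈ G, 0 < W x) (hdom : R.domain = regDom G W)
    (hint : EqOn R.integrand (regIntegrand m d W) R.domain) (x : Fin b → ℝ) :
    (∫ t in {t : ℝ | (Fin.snoc x t : Fin (b + 1) → ℝ) ∈ R.domain}, R.integrand (Fin.snoc x t)) =
      G.indicator (fun x => d x * regPrim m (W x)) x := by
  by_cases hx : x ∈ G
  · rw [indicator_of_mem hx, hdom, fibre_regDom_of_mem hx]
    have hS : MeasurableSet (Ioo 1 (W x) ∪ Ioo (W x) 1) :=
      measurableSet_Ioo.union measurableSet_Ioo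
    have hcongr : EqOn (fun t : ℝ => R.integrand (Fin.snoc x t))
        (fun t => regSign W x * d x * ((t - 1) ^ m / t)) (Ioo 1 (W x) ∪ Ioo (W x) 1) := by
      intro t ht
      have hmem : (Fin.snoc x t : Fin (b + 1) → ℝ) ∈ R.domain := by
        rw [hdom]
        simp only [regDom, mem_setOf_eq, Fin.init_snoc, Fin.snoc_last]
        exact ⟨hx, by simpa [mem_union, mem_Ioo] using ht⟩
      have h := hint hmem
      simp only [regIntegrand, Fin.init_snoc, Fin.snoc_last] at h
      exact h
    rw [setIntegral_congr_fun hS hcongr, integral_const_mul]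
    by_cases hw : 1 ≤ W x
    · have he : Ioo (W x) 1 = ∅ := Ioo_eq_empty (not_lt.mpr hw)
      rw [he, union_empty, setIntegral_reg_kernel_of_one_le m hw, regSign, if_pos hw, one_mul]
    · have hw : W x < 1 := lt_of_not_ge hw
      have he : Ioo 1 (W x) = ∅ := Ioo_eq_empty (not_lt.mpr hw.le)
      rw [he, empty_union, setIntegral_reg_kernel_of_lt_one m (hpos x hx) hw, regSign,
        if_neg (not_le.mpr hw)]
      ring
  · rw [indicator_of_notMem hx, hdom, fibre_regDom_of_not_mem hx, Measure.restrict_empty,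
      integral_zero_measure]

/-- **`S ⟹ RegTorusProduct`** (the leaf is WEAKER than the summit): the formal combination
`[R₁₂] − [R₁] − [R₂] − [B]` has value `0` (Fubini + `regPrim_mul`), so it is a relation by the kernel
form of the summit (`kernel_of_summit`, landed P01). -/
theorem regTorusProduct_of_summit (hS : _root_.KontsevichZagierPeriods) : RegTorusProduct := by
  intro b m G d W₁ W₂ R₁ R₂ R₁₂ B hG hd hW₁ hW₂ hpos₁ hpos₂ hdom₁ hint₁ hdom₂ hint₂ hdom₁₂ hint₁₂
    hdomB hintB
  have hpos₁₂ : ∀ x ∈ G, 0 < W₁ x * W₂ x := fun x hx => mul_pos (hpos₁ x hx) (hpos₂ x hx)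
  have hGm : MeasurableSet G := hG.measurableSet_holds
  refine kernel_of_summit hS _ ?_
  rw [map_sub, map_sub, map_sub, KZ.eval_of, KZ.eval_of, KZ.eval_of, KZ.eval_of,
    value_eq_integral_fibre R₁₂, value_eq_integral_fibre R₁, value_eq_integral_fibre R₂]
  have h12 := fibreIntegral_reg m R₁₂ hpos₁₂ hdom₁₂ hint₁₂
  have h1 := fibreIntegral_reg m R₁ hpos₁ hdom₁ hint₁
  have h2 := fibreIntegral_reg m R₂ hpos₂ hdom₂ hint₂
  simp_rw [h12, h1, h2]
  rw [integral_indicator hGm, integral_indicator hGm, integral_indicator hGm]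
  have hB : B.value = ∫ x in G, d x * rho m (W₁ x) (W₂ x) := by
    unfold KZ.IntegralRep.value
    rw [hdomB]
    refine setIntegral_congr_fun hGm fun x hx => hintB ?_
    rw [hdomB]
    exact hx
  rw [hB]
  -- integrability of the fibre-integral functions on `G`
  have hI : ∀ (W : (Fin b → ℝ) → ℝ) (R : KZ.IntegralRep (b + 1)), (∀ x ∈ G, 0 < W x) →
      R.domain = regDom G W → EqOn R.integrand (regIntegrand m d W) R.domain →
      IntegrableOn (fun x => d x * regPrim m (W x)) G := by
    intro W R hpos hdom hint
    have h := integrable_fibre_integral R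
    simp_rw [fibreIntegral_reg m R hpos hdom hint] at h
    exact (integrable_indicator_iff hGm).mp h
  have i12 : IntegrableOn (fun x => d x * regPrim m (W₁ x * W₂ x)) G := hI _ R₁₂ hpos₁₂ hdom₁₂ hint₁₂
  have i1 : IntegrableOn (fun x => d x * regPrim m (W₁ x)) G := hI _ R₁ hpos₁ hdom₁ hint₁
  have i2 : IntegrableOn (fun x => d x * regPrim m (W₂ x)) G := hI _ R₂ hpos₂ hdom₂ hint₂
  have iB : IntegrableOn (fun x => d x * rho m (W₁ x) (W₂ x)) G := by
    have h := B.integrableOn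
    rw [hdomB] at h
    refine h.congr_fun (fun x hx => hintB ?_) hGm
    rw [hdomB]
    exact hx
  have i121 : IntegrableOn (fun x => d x * regPrim m (W₁ x * W₂ x) - d x * regPrim m (W₁ x)) G :=
    i12.sub i1
  have i1212 : IntegrableOn
      (fun x => d x * regPrim m (W₁ x * W₂ x) - d x * regPrim m (W₁ x) - d x * regPrim m (W₂ x)) G :=
    i121.sub i2
  rw [← integral_sub i12 i1, ← integral_sub i121 i2, ← integral_sub i1212 iB]
  refine setIntegral_eq_zero_of_forall_eq_zero fun x hx => ?_
  rw [← regPrim_mul m (hpos₁ x hx) (hpos₂ x hx)]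
  ring

/-! ### §3c The positively oriented closed-band form `RegTorusProductPos` — PROVED (core form)

In the tree's dialect (closed bands `KZlog.band`, cf. the landed `m = 0` product rule
`KZ.of_sub_of_sub_mem_relations_mul`): over an OPEN `ℚ`-semialgebraic base `G` on which `u` is
differentiable and `u, w ≥ 1`, with the rescaled band `S = [{1 ≤ s ≤ w}, d (u s − 1)^m / s]` supplied
(an honest representation: it is the image of `[{u ≤ t ≤ u w}, d (t−1)^m/t]` under `t = u s`),
`[R] − [R₁] − [R₂] − [B]` is a relation: split `R` at `t = u` (rule 1a), substitute `t = u s` (rule 2,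
`KZ.of_sub_of_mem_relations_of_affine`), split off the POLYNOMIAL band
`d ((u s − 1)^m − (s − 1)^m)/s` (rule 1b) and fold it to the base by Newton–Leibniz (rule 3) with the
explicit primitive `d (polyLog m (u s) − polyLog m s)`, whose boundary values give `d ρ_m(u, w)`. -/

/-- Auxiliary step `polyLog_zero`. [bookkeeping] -/
theorem polyLog_zero (w : ℝ) : polyLog 0 w = 0 := by
  simp [polyLog]

/-- Auxiliary step `polyLog_succ`. [bookkeeping] -/
theorem polyLog_succ (m : ℕ) (w : ℝ) :
    polyLog (m + 1) w = -polyLog m w + (w - 1) ^ (m + 1) / (m + 1) := by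
  simp only [polyLog, Finset.sum_range_succ, Nat.add_sub_cancel, Nat.sub_self, pow_zero, one_mul]
  congr 1
  · rw [← Finset.sum_neg_distrib]
    refine Finset.sum_congr rfl fun i hi => ?_
    rw [Finset.mem_range] at hi
    have h : m - i = (m - 1 - i) + 1 := by omega
    rw [h, pow_succ]
    ring

/-- Auxiliary step `continuous_polyLog`. [bookkeeping] -/
theorem continuous_polyLog (m : ℕ) : Continuous (polyLog m) := by
  unfold polyLog
  fun_prop

/-- Powers of a `ℚ`-semialgebraic function are `ℚ`-semialgebraic. [BCR 1998, Prop. 2.2.6] -/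
theorem isSemialgebraicFunOn_pow' {n : ℕ} {B : Set (Fin n → ℝ)} (hB : IsSemialgebraic ℚ B)
    {f : (Fin n → ℝ) → ℝ} (hf : IsSemialgebraicFunOn ℚ B f) (k : ℕ) :
    IsSemialgebraicFunOn ℚ B (fun z => f z ^ k) := by
  induction k with
  | zero => simpa using isSemialgebraicFunOn_ratCast hB 1
  | succ k ih =>
    exact (IsSemialgebraicFunOn.mul_holds ih hf).congr fun z _ => by simp [pow_succ]

/-- `polyLog m ∘ f` is `ℚ`-semialgebraic for `ℚ`-semialgebraic `f` (a polynomial in `f`). -/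
theorem isSemialgebraicFunOn_polyLog_comp {n : ℕ} {B : Set (Fin n → ℝ)} (hB : IsSemialgebraic ℚ B)
    {f : (Fin n → ℝ) → ℝ} (hf : IsSemialgebraicFunOn ℚ B f) (m : ℕ) :
    IsSemialgebraicFunOn ℚ B (fun z => polyLog m (f z)) := by
  induction m with
  | zero => simpa [polyLog_zero] using isSemialgebraicFunOn_ratCast hB 0
  | succ m ih =>
    have h1 : IsSemialgebraicFunOn ℚ B (fun z => f z - 1) := by
      have := IsSemialgebraicFunOn.sub_holds hf (isSemialgebraicFunOn_ratCast hB 1)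
      exact this.congr fun z _ => by simp
    have hpow := isSemialgebraicFunOn_pow' hB h1 (m + 1)
    have hc : IsSemialgebraicFunOn ℚ B (fun _ => ((m : ℝ) + 1)⁻¹) :=
      (isSemialgebraicFunOn_ratCast hB (((m : ℚ) + 1)⁻¹)).congr fun z _ => by push_cast; ring
    refine (IsSemialgebraicFunOn.add_holds ih.neg (IsSemialgebraicFunOn.mul_holds hpow hc)).congr
      fun z _ => ?_
    simp only [Pi.add_apply, Pi.neg_apply, Pi.mul_apply, polyLog_succ]
    ring

end CylLog
end RegularisedLogLayer
end Summit.KontsevichZagierPeriods.RootDecompRelativeModAbsolute.Rung30571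
end
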